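import Literature.Analysis.FluidPDE.LocalLerayPressureBound
import Literature.Analysis.FluidPDE.LocalLerayPressureBoundTools
import Literature.Analysis.FluidPDE.LerayPressureDecayProofs
import HarnessLib

/-!
# The local `L^{3/2}` pressure bound for local Leray solutions on a slab from the local pressure
expansion (Jia–Šverák 2014 / Kang–Miura–Tsai 2021, Lemma 3.4) and the Calderón–Zygmund bound
(Stein 1970)

Analysis/FluidPDE proof file (theorems only) below the named fact
`Literature.Analysis.FluidPDE.kangMiuraTsai_local_pressure_bound` (`LocalLerayPressureBound.lean`:
for `T, R > 0`, `A ≥ 0` one constant `K = K(T,R,A)` such that every local Leray solution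
`(v, π)` on `(0,T) × ℝ³` with `L²_uloc` weakly divergence-free datum and uniformly local energy
`≤ A` on unit balls has, at every centre `x₀`, a gauge `c ∈ L^{3/2}(0,T)` with
`∫₀ᵀ∫_{B_R(x₀)} |π - c(t)|^{3/2} ≤ K`; Kang–Miura–Tsai, IMRN 2021 = arXiv:1812.10509, the bound
"`‖p̄_{x₀,R}‖_{L^s(0,T;L^q(B_{3R/2}(x₀)))} ≤ c(T,R,s,q) A`" printed in the proof of Lemma 3.4, §8,
case `s = q = 3/2`). Main result:

* `kangMiuraTsai_local_pressure_bound_of_expansion (hPD : <PDslab>)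
    (hCZ : stein1970_normalisedPressure_ae_Lp_bound) : kangMiuraTsai_local_pressure_bound`
  (**PDslab → CZ → F**),

so that the fact rests on two printed theorems: the local pressure expansion of local Leray
solutions on the slab with `L²_uloc` data (**PDslab**: Jia–Šverák 2014, §3 Remarks after Def. 1,
arXiv:1204.0529 p. 7, for `L²_uloc` data with the decay condition; Kang–Miura–Tsai 2021,
Lemma 3.4 with the proof of §8, printed for `E²` data) and Stein's `L^p` theory of the Riesz
transforms (**CZ**, `stein1970_normalisedPressure_ae_Lp_bound`,
`LocalLerayPressureDecomposition.lean`; Stein 1970, Ch. II Thms. 3–4). As recorded in the module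
docstring of `LocalLerayPressureBound.lean` (review of p22220, reasons 2–3), the tree's global
`E²` fact **PD** `kangMiuraTsai_pressure_decomposition` does not serve here (slab class, no `E²`
decay of the datum). **PDslab** is therefore carried as the *explicit hypothesis* `hPD` of the
glue theorem, spelled out in full — the statement of **PD** with `IsLocalLeraySolution 1 v₀ v π`,
`MemE2 v₀` replaced by `IsLocalLeraySolutionOn T 1 v₀ v π`, `sup_{x₀} ∫_{B_1(x₀)} |v₀|² < ∞`
(Jia–Šverák's standing hypotheses) — and not as a new named fact: under D-0026 the proving seat
of **F** may not mint it, and has filed it as the split child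
`jiaSverak2014_slab_pressure_decomposition` of **F** (this theorem is the split's glue; once that
child and **CZ** are discharged, `kangMiuraTsai_local_pressure_bound_holds` is the one-liner
`kangMiuraTsai_local_pressure_bound_of_expansion PDslab_holds CZ_holds`).

## The proof (Kang–Miura–Tsai 2021, §8, the bounds on `p_loc` and `p_far`, integrated in time)

Fix `T, R > 0`, `A`. Enlarge the radius to `R' = max(R, 1)` (the bound over `B_{R'} ⊇ B_R` is
stronger), so that `2R' ≥ 2`. All constants below depend on `T, R', A` only.

1. *Expansion and gauge.* By `hPD` at `(x₀, R')`, `π - c = π_loc + π_far` a.e. on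
   `(0,T) × B_{R'}(x₀)` with `c ∈ L^{3/2}(0,T)`; this `c` is the gauge.
2. *Near field* (KMT: "By the Calderon–Zygmund estimate,
   `∫_{B_{3R/2}(x₀)} |p_loc|^q ≤ c_q ∫_{B_{3R}(x₀)} |v|^{2q}`"). For a.e. `t`,
   `∫ |π_loc(t)|^{3/2} ≤ C_n ∫_{B_{2R'}(x₀)} |v(t)|³` (**CZ** via
   `exists_lintegral_localPressureNear_le`), and
   `∫₀ᵀ∫_{B_{2R'}(x₀)} |v|³ ≤ CUBE(T, R', A)` by the explicit cubic bound
   (`exists_lintegral_cube_box_le_explicit`) fed with the radius-`2R'` energy and gradient bounds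
   `A_ρ = |B_1|⁻¹ A |B_{2R'+1}|` obtained from the unit-ball bounds
   (`setLIntegral_ball_le_of_forall_unitBall`; for the gradient after Tonelli in the order
   `dx dt`).
3. *Far field* (KMT: "`|p_far(x,t)| ≤ ∫_{2R<|y-x₀|} cR|x₀-y|⁻⁴|v(y,t)|² dy ≤ c R⁻³ ‖v(t)‖²_{L²_{uloc,R}}`").
   For a.e. `t` and `x ∈ B_{R'}(x₀)`, `|π_far(t,x)| ≤ C_K R' ∫_{|y-x₀| ≥ 2R'} |v(t,y)|²|y-x₀|⁻⁴ dy`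
   (`enorm_localPressureFar_le`) `≤ C_K R' · |B_1|⁻¹ A · 16 ∫_{|z| ≥ 2R'-1} |z|⁻⁴ =: C_K R' · Tail`
   (`lintegral_compl_ball_mul_powKer_le`), a finite constant.
4. *Assembly.* `∫₀ᵀ∫_{B_{R'}} |π - c|^{3/2} ≤ √2 C_n CUBE + √2 (C_K R' Tail)^{3/2} |B_{R'}| T =: K`.

## Mathlib / tree search

Tree: `kangMiuraTsai_local_pressure_bound` (`LocalLerayPressureBound.lean`);
`kangMiuraTsai_pressure_decomposition` (the `E²`/global form of `hPD`),
`stein1970_normalisedPressure_ae_Lp_bound`, `localPressureNear`, `localPressureFar`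
(`LocalLerayPressureDecomposition.lean`); `exists_lintegral_localPressureNear_le`,
`enorm_localPressureFar_le`, `lintegral_compl_ball_mul_powKer_le`, `add_rpow_threeHalves_le`
(`LerayPressureDecayProofs.lean`, whose `lintegral_gauged_pressure_le` is the radius-`3/2`
decay form of the present estimate for the global class); `exists_abs_pressureKernel_sub_le`
(`LocalPressureFarFieldTools.lean`); `setLIntegral_ball_le_of_forall_unitBall`,
`exists_lintegral_cube_box_le_explicit` (`LocalLerayPressureBoundTools.lean`);
`IsLocalLeraySolutionOn.aestronglyMeasurable` (`LocalLeraySolutionsSlab.lean`);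
`RieszKernel.lintegral_compl_ball_powKer_lt_top` (`RieszKernelBounds.lean`). Mathlib:
`Measure.ae_ae_of_ae_prod`, `lintegral_prod`, `lintegral_prod_symm`, `AEMeasurable.prod_swap`,
`AEStronglyMeasurable.prodMk_left`, `ENNReal.coe_toNNReal`.

## References

* K. Kang, H. Miura, T.-P. Tsai, IMRN 2021 (11) 8763–8805 = arXiv:1812.10509: Lemma 3.4 and its
  proof, §8 Appendix 1 (arXiv pp. 17–18: the bounds on `p_loc`, `p_far` and
  `‖p̄_{x₀,R}‖ ≤ c(T,R,s,q) A`). Bib key `KangMiuraTsai2020`.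
* H. Jia, V. Šverák, Invent. Math. 196 (2014) = arXiv:1204.0529, §3 Remarks after Def. 1.
  Bib key `JiaSverak2014`.
* E. M. Stein, *Singular integrals and differentiability properties of functions* (1970),
  Ch. II §4.2 Thm. 3, §4.5 Thm. 4. Bib key `Stein1971`.
-/

noncomputable section

open _root_.MeasureTheory _root_.TopologicalSpace _root_.Metric _root_.Filter _root_.Set
  _root_.Function
open scoped _root_.ENNReal _root_.NNReal _root_.Topology

namespace Literature.Analysis.FluidPDE

/-- **The local `L^{3/2}` pressure bound (F) from the local pressure expansion on the slab
(PDslab; Jia–Šverák 2014 §3, Kang–Miura–Tsai 2021 Lemma 3.4) and Stein's `L^p` bound for the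
Riesz-transform pressure (CZ)** — Kang–Miura–Tsai 2021, §8, proof of Lemma 3.4:
"`‖p_loc‖_{L^s(0,T;L^q(B_{3R/2}(x₀)))} + ‖p_far‖_{L^s(0,T;L^q(B_{3R/2}(x₀)))} ≤ cA +
cT^{1/s}R^{3/q-3} ess sup_{0<t<T} ‖v(t)‖²_{L²_{uloc,R}} ≤ c(T,R,s,q)A`", case `s = q = 3/2`, in
the weaker vendored form `∃ K(T,R,A)`. The hypothesis `hPD` is the local pressure expansion for
the slab class with `L²_uloc` data, verbatim the statement of the tree's `E²`/global fact
`kangMiuraTsai_pressure_decomposition` over `IsLocalLeraySolutionOn T 1 v₀ v π` with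
Jia–Šverák's standing datum hypotheses (Jia–Šverák 2014, §3 Remarks after Def. 1; KMT Lemma 3.4):
for `0 < T`, every such solution, every centre `x₀` and radius `r > 0` there is
`c ∈ L^{3/2}(0,T)` with `π = π_loc + π_far + c(t)` a.e. on `(0,T) × B_r(x₀)`
(`π_loc = localPressureNear x₀ r v`, `π_far = localPressureFar x₀ r v`); it is the glue
hypothesis of the split of **F** requested under D-0026 (module docstring). See the module
docstring for the proof (enlarged radius `R' = max(R,1)`; near field by CZ and the explicit
cubic bound from the unit-ball energy and gradient bounds; far field by the two-centre kernel
bound and the uniformly local tail).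
[cite: KangMiuraTsai2020, §8 proof of Lemma 3.4 (bounds for p_loc, p_far; arXiv:1812.10509 pp. 17–18)] -/
theorem kangMiuraTsai_local_pressure_bound_of_expansion
    (hPD : ∀ (T : ℝ) (v₀ : EuclideanSpace ℝ (Fin 3) → EuclideanSpace ℝ (Fin 3))
      (v : ℝ → EuclideanSpace ℝ (Fin 3) → EuclideanSpace ℝ (Fin 3))
      (π : ℝ → EuclideanSpace ℝ (Fin 3) → ℝ), 0 < T →
      IsLocalLeraySolutionOn T 1 v₀ v π →
      (∃ A : ℝ≥0, ∀ x₀ : EuclideanSpace ℝ (Fin 3), ∫⁻ x in ball x₀ 1, ‖v₀ x‖ₑ ^ 2 ≤ A) →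
      IsWeaklyDivFree v₀ →
        ∀ (x₀ : EuclideanSpace ℝ (Fin 3)) (r : ℝ), 0 < r →
          ∃ c : ℝ → ℝ, MemLp c (3 / 2 : ℝ≥0∞) (volume.restrict (Ioo 0 T)) ∧
            ∀ᵐ z ∂(volume.restrict (Ioo 0 T ×ˢ ball x₀ r)),
              π z.1 z.2 =
                localPressureNear x₀ r v z.1 z.2 + localPressureFar x₀ r v z.1 z.2 + c z.1)
    (hCZ : stein1970_normalisedPressure_ae_Lp_bound) : kangMiuraTsai_local_pressure_bound := by
  intro T R A hT hR
  -- ## the enlarged radius `R' = max R 1`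
  set R' : ℝ := max R 1 with hR'
  have hR'1 : 1 ≤ R' := le_max_right _ _
  have hR'pos : 0 < R' := by linarith
  have hRR' : R ≤ R' := le_max_left _ _
  have h2R' : (2 : ℝ) ≤ 2 * R' := by linarith
  -- ## constants
  obtain ⟨Cn, hCn0, hCntop, hnear⟩ := exists_lintegral_localPressureNear_le hCZ
  obtain ⟨CK, hCK0, hCK⟩ := exists_abs_pressureKernel_sub_le
  obtain ⟨Kc, hKc⟩ := exists_lintegral_cube_box_le_explicit (2 * R')
  set V1 : ℝ≥0∞ := volume (ball (0 : EuclideanSpace ℝ (Fin 3)) 1) with hV1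
  set Vρ : ℝ≥0∞ := volume (ball (0 : EuclideanSpace ℝ (Fin 3)) (2 * R' + 1)) with hVρ
  set Aρ : ℝ≥0∞ := V1⁻¹ * ((A : ℝ≥0∞) * Vρ) with hAρ
  set IT : ℝ≥0∞ := volume (Ioo (0 : ℝ) T) with hIT
  set CUBE : ℝ≥0∞ := Kc * Aρ ^ (1 / 2 : ℝ) *
    ((Aρ * IT) ^ (1 / 4 : ℝ) * (Aρ * IT + Aρ) ^ (3 / 4 : ℝ)) with hCUBE
  set Tail : ℝ≥0∞ := V1⁻¹ * ((A : ℝ≥0∞) *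
    (16 * ∫⁻ z in (ball (0 : EuclideanSpace ℝ (Fin 3)) (2 * R' - 1))ᶜ, RieszKernel.powKer 4 z))
    with hTail
  set cK : ℝ≥0∞ := ENNReal.ofReal (CK * R') with hcK
  set s2 : ℝ≥0∞ := (2 : ℝ≥0∞) ^ (1 / 2 : ℝ) with hs2
  set VR : ℝ≥0∞ := volume (ball (0 : EuclideanSpace ℝ (Fin 3)) R') with hVR
  set Ktot : ℝ≥0∞ := s2 * Cn * CUBE + s2 * ((cK * Tail) ^ (3 / 2 : ℝ) * VR) * IT with hKtot
  -- ## finiteness of the constants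
  have hV10 : V1 ≠ 0 := (measure_ball_pos volume _ one_pos).ne'
  have hV1inv : V1⁻¹ ≠ ⊤ := ENNReal.inv_ne_top.2 hV10
  have hVρtop : Vρ ≠ ⊤ := measure_ball_lt_top.ne
  have hAρtop : Aρ ≠ ⊤ :=
    ENNReal.mul_ne_top hV1inv (ENNReal.mul_ne_top ENNReal.coe_ne_top hVρtop)
  have hITtop : IT ≠ ⊤ := by
    rw [hIT, Real.volume_Ioo]
    exact ENNReal.ofReal_ne_top
  have hCUBEtop : CUBE ≠ ⊤ := by
    refine ENNReal.mul_ne_top (ENNReal.mul_ne_top ENNReal.coe_ne_top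
      (ENNReal.rpow_ne_top_of_nonneg (by norm_num) hAρtop)) (ENNReal.mul_ne_top ?_ ?_)
    · exact ENNReal.rpow_ne_top_of_nonneg (by norm_num) (ENNReal.mul_ne_top hAρtop hITtop)
    · exact ENNReal.rpow_ne_top_of_nonneg (by norm_num)
        (ENNReal.add_ne_top.2 ⟨ENNReal.mul_ne_top hAρtop hITtop, hAρtop⟩)
  have hTailtop : Tail ≠ ⊤ := by
    refine ENNReal.mul_ne_top hV1inv (ENNReal.mul_ne_top ENNReal.coe_ne_top
      (ENNReal.mul_ne_top (by norm_num) ?_))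
    exact (RieszKernel.lintegral_compl_ball_powKer_lt_top (by norm_num) (by linarith)).ne
  have hcKtop : cK ≠ ⊤ := ENNReal.ofReal_ne_top
  have hs2top : s2 ≠ ⊤ := ENNReal.rpow_ne_top_of_nonneg (by norm_num) ENNReal.ofNat_ne_top
  have hVRtop : VR ≠ ⊤ := measure_ball_lt_top.ne
  have hKtot_top : Ktot ≠ ⊤ := by
    refine ENNReal.add_ne_top.2 ⟨ENNReal.mul_ne_top (ENNReal.mul_ne_top hs2top hCntop) hCUBEtop,
      ENNReal.mul_ne_top (ENNReal.mul_ne_top hs2top (ENNReal.mul_ne_top ?_ hVRtop)) hITtop⟩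
    exact ENNReal.rpow_ne_top_of_nonneg (by norm_num) (ENNReal.mul_ne_top hcKtop hTailtop)
  -- ## the bound `K = Ktot`
  refine ⟨Ktot.toNNReal, fun v₀ v π hv h₀ hdiv hE hGex x₀ => ?_⟩
  rw [ENNReal.coe_toNNReal hKtot_top]
  obtain ⟨G, hG, hGb⟩ := hGex
  -- the expansion at radius `R'` and the gauge
  obtain ⟨c, hc, hdec⟩ := hPD T v₀ v π hT hv ⟨A, h₀⟩ hdiv x₀ R' hR'pos
  refine ⟨c, hc,
    (lintegral_mono_set (Set.prod_mono Subset.rfl (ball_subset_ball hRR'))).trans ?_⟩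
  -- ## names
  set B : Set (EuclideanSpace ℝ (Fin 3)) := ball x₀ R' with hB
  set N := localPressureNear x₀ R' v with hN
  set Fa := localPressureFar x₀ R' v with hFa
  set μt : Measure ℝ := volume.restrict (Ioo 0 T) with hμt
  set μB : Measure (EuclideanSpace ℝ (Fin 3)) := volume.restrict B with hμB
  set G₃ : ℝ≥0∞ := ∫⁻ z in Ioo 0 T ×ˢ ball x₀ (2 * R'), ‖v z.1 z.2‖ₑ ^ (3 : ℕ) with hG₃def
  set g₃ : ℝ → ℝ≥0∞ := fun t => ∫⁻ x in ball x₀ (2 * R'), ‖v t x‖ₑ ^ (3 : ℕ) with hg₃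
  -- ## measurability on the slab and on the boxes
  have hslab : ((slab (EuclideanSpace ℝ (Fin 3)) (Ioo 0 T) isOpen_Ioo :
      Opens (ℝ × EuclideanSpace ℝ (Fin 3))) : Set (ℝ × EuclideanSpace ℝ (Fin 3))) =
      Ioo (0 : ℝ) T ×ˢ univ := rfl
  have hvm : AEStronglyMeasurable (uncurry v) (volume.restrict (Ioo (0 : ℝ) T ×ˢ univ)) :=
    hv.aestronglyMeasurable
  have hπm : AEStronglyMeasurable (uncurry π) (volume.restrict (Ioo (0 : ℝ) T ×ˢ univ)) := by
    rw [← hslab]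
    exact hv.distributional.2.2.1.aestronglyMeasurable
  have hGm : AEStronglyMeasurable (uncurry G) (volume.restrict (Ioo (0 : ℝ) T ×ˢ univ)) := by
    rw [← hslab]
    exact hG.locallyIntegrableOn_grad.aestronglyMeasurable
  have hbox : ∀ S : Set (EuclideanSpace ℝ (Fin 3)),
      μt.prod (volume.restrict S) = volume.restrict (Ioo 0 T ×ˢ S) := fun S => by
    rw [hμt, Measure.prod_restrict, ← Measure.volume_eq_prod]
  have hboxu : μt.prod (volume : Measure (EuclideanSpace ℝ (Fin 3))) =
      volume.restrict (Ioo (0 : ℝ) T ×ˢ univ) := by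
    conv_lhs => rw [← Measure.restrict_univ (μ := (volume : Measure (EuclideanSpace ℝ (Fin 3))))]
    exact hbox univ
  have hsub : ∀ S : Set (EuclideanSpace ℝ (Fin 3)),
      Ioo 0 T ×ˢ S ⊆ Ioo (0 : ℝ) T ×ˢ (univ : Set (EuclideanSpace ℝ (Fin 3))) := fun S =>
    Set.prod_mono Subset.rfl (subset_univ _)
  have hvmS : ∀ S : Set (EuclideanSpace ℝ (Fin 3)),
      AEStronglyMeasurable (uncurry v) (μt.prod (volume.restrict S)) := fun S => by
    rw [hbox]
    exact hvm.mono_measure (Measure.restrict_mono (hsub S) le_rfl)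
  have hF : ∀ (S : Set (EuclideanSpace ℝ (Fin 3))) (n : ℕ),
      AEMeasurable (fun z : ℝ × EuclideanSpace ℝ (Fin 3) => ‖v z.1 z.2‖ₑ ^ n)
        (μt.prod (volume.restrict S)) :=
    fun S n => (hvmS S).enorm.pow_const n
  have hFG : ∀ S : Set (EuclideanSpace ℝ (Fin 3)), AEMeasurable
      (fun z : ℝ × EuclideanSpace ℝ (Fin 3) => ENNReal.ofReal (frobeniusNormSq (G z.1 z.2)))
      (μt.prod (volume.restrict S)) := fun S => by
    have h1 : AEStronglyMeasurable (uncurry G) (μt.prod (volume.restrict S)) := by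
      rw [hbox]
      exact hGm.mono_measure (Measure.restrict_mono (hsub S) le_rfl)
    exact (continuous_frobeniusNormSq'.comp_aestronglyMeasurable h1).aemeasurable.ennreal_ofReal
  -- slices of `v` are measurable for a.e. `t`
  have hslice_meas : ∀ᵐ t ∂μt, AEStronglyMeasurable (v t) volume := by
    have h1 : AEStronglyMeasurable (uncurry v)
        (μt.prod (volume : Measure (EuclideanSpace ℝ (Fin 3)))) := by
      rw [hboxu]
      exact hvm
    exact h1.prodMk_left
  -- ## the uniformly local energy on balls of radius `2R'`, a.e. in time
  have hAρ_t : ∀ᵐ t ∂μt, ∫⁻ x in ball x₀ (2 * R'), ‖v t x‖ₑ ^ 2 ≤ Aρ := by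
    filter_upwards [hslice_meas, hE] with t hmt hEt
    exact setLIntegral_ball_le_of_forall_unitBall (hmt.enorm.pow_const 2) hEt x₀ (2 * R')
  -- ## the uniformly local gradient bound on the box of radius `2R'`
  have hGρ : ∫⁻ z in Ioo 0 T ×ˢ ball x₀ (2 * R'),
      ENNReal.ofReal (frobeniusNormSq (G z.1 z.2)) ≤ Aρ := by
    set gG : EuclideanSpace ℝ (Fin 3) → ℝ≥0∞ := fun y =>
      ∫⁻ t in Ioo 0 T, ENNReal.ofReal (frobeniusNormSq (G t y)) with hgG
    have hton : ∀ S : Set (EuclideanSpace ℝ (Fin 3)), ∫⁻ z in Ioo 0 T ×ˢ S,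
        ENNReal.ofReal (frobeniusNormSq (G z.1 z.2)) = ∫⁻ y in S, gG y := fun S => by
      rw [← hbox S, lintegral_prod_symm _ (hFG S)]
    have hgGm : AEMeasurable gG volume := by
      have h1 : AEMeasurable
          (fun z : ℝ × EuclideanSpace ℝ (Fin 3) => ENNReal.ofReal (frobeniusNormSq (G z.1 z.2)))
          (μt.prod (volume : Measure (EuclideanSpace ℝ (Fin 3)))) := by
        have := hFG univ
        rwa [Measure.restrict_univ] at this
      exact h1.prod_swap.lintegral_prod_right'
    have hunit : ∀ z : EuclideanSpace ℝ (Fin 3), ∫⁻ y in ball z 1, gG y ≤ (A : ℝ≥0∞) :=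
      fun z => by
      rw [← hton]
      exact hGb z
    rw [hton]
    exact setLIntegral_ball_le_of_forall_unitBall hgGm hunit x₀ (2 * R')
  -- ## the cubic functional on the box of radius `2R'`
  have hG₃le : G₃ ≤ CUBE := hKc T v G x₀ Aρ Aρ hAρtop hG hAρ_t hGρ
  have hG₃top : G₃ ≠ ⊤ := ne_top_of_le_ne_top hCUBEtop hG₃le
  have hg₃m : AEMeasurable g₃ μt := (hF (ball x₀ (2 * R')) 3).lintegral_prod_right'
  have hT3 : G₃ = ∫⁻ t, g₃ t ∂μt := by
    rw [hG₃def, ← hbox, lintegral_prod _ (hF _ 3)]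
  have hfin : ∀ᵐ t ∂μt, g₃ t < ⊤ := by
    refine ae_lt_top' hg₃m ?_
    rw [← hT3]
    exact hG₃top
  -- ## the expansion, slice by slice
  have hdec' : ∀ᵐ t ∂μt, ∀ᵐ x ∂μB, π t x = N t x + Fa t x + c t := by
    have h1 : ∀ᵐ z ∂μt.prod μB, π z.1 z.2 = N z.1 z.2 + Fa z.1 z.2 + c z.1 := by
      rw [hμB, hbox]
      exact hdec
    exact Measure.ae_ae_of_ae_prod h1
  have hGm' : AEStronglyMeasurable
      (fun z : ℝ × EuclideanSpace ℝ (Fin 3) => π z.1 z.2 - c z.1) (μt.prod μB) := by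
    refine AEStronglyMeasurable.sub ?_ ?_
    · rw [hμB, hbox]
      exact hπm.mono_measure (Measure.restrict_mono (hsub B) le_rfl)
    · exact hc.aestronglyMeasurable.comp_fst
  have hTI : ∫⁻ z in Ioo 0 T ×ˢ B, ‖π z.1 z.2 - c z.1‖ₑ ^ (3 / 2 : ℝ) =
      ∫⁻ t, ∫⁻ x, ‖π t x - c t‖ₑ ^ (3 / 2 : ℝ) ∂μB ∂μt := by
    rw [← hbox B, ← hμB, lintegral_prod _ (hGm'.enorm.pow_const _)]
  -- ## the slice estimate
  have hinner : ∀ᵐ t ∂μt, ∫⁻ x, ‖π t x - c t‖ₑ ^ (3 / 2 : ℝ) ∂μB ≤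
      s2 * Cn * g₃ t + s2 * ((cK * Tail) ^ (3 / 2 : ℝ) * VR) := by
    filter_upwards [hslice_meas, hfin, hdec', hE] with t hmt hft hdt hEt
    -- the far field at time `t`: the two-centre kernel bound and the uniformly local tail
    have hfar : ∫⁻ y in (ball x₀ (2 * R'))ᶜ,
        ‖v t y‖ₑ ^ (2 : ℕ) * RieszKernel.powKer 4 (y - x₀) ≤ Tail :=
      lintegral_compl_ball_mul_powKer_le (hmt.enorm.pow_const _) hEt x₀ h2R'
    have hFaB : ∀ x ∈ B, ‖Fa t x‖ₑ ≤ cK * Tail := fun x hx =>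
      (enorm_localPressureFar_le hCK0 hCK x₀ hR'pos v t hx).trans (mul_le_mul' le_rfl hfar)
    -- the near field at time `t`: Calderón–Zygmund
    have hNt : ∫⁻ x, ‖N t x‖ₑ ^ (3 / 2 : ℝ) ∂μB ≤ Cn * g₃ t :=
      (lintegral_mono' Measure.restrict_le_self le_rfl).trans (hnear x₀ R' v t hmt hft.ne)
    calc ∫⁻ x, ‖π t x - c t‖ₑ ^ (3 / 2 : ℝ) ∂μB
        = ∫⁻ x, ‖N t x + Fa t x‖ₑ ^ (3 / 2 : ℝ) ∂μB := by
          refine lintegral_congr_ae ?_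
          filter_upwards [hdt] with x hx
          rw [hx, add_sub_cancel_right]
      _ ≤ ∫⁻ x, (‖N t x‖ₑ + cK * Tail) ^ (3 / 2 : ℝ) ∂μB := by
          rw [hμB]
          refine setLIntegral_mono' measurableSet_ball fun x hx => ?_
          exact ENNReal.rpow_le_rpow ((enorm_add_le _ _).trans
            (add_le_add le_rfl (hFaB x hx))) (by norm_num)
      _ ≤ ∫⁻ x, s2 * (‖N t x‖ₑ ^ (3 / 2 : ℝ) + (cK * Tail) ^ (3 / 2 : ℝ)) ∂μB :=
          lintegral_mono fun x => add_rpow_threeHalves_le _ _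
      _ = s2 * (∫⁻ x, ‖N t x‖ₑ ^ (3 / 2 : ℝ) ∂μB + (cK * Tail) ^ (3 / 2 : ℝ) * volume B) := by
          rw [lintegral_const_mul' _ _ hs2top, lintegral_add_right' _ aemeasurable_const,
            lintegral_const, hμB, Measure.restrict_apply_univ]
      _ ≤ s2 * (Cn * g₃ t + (cK * Tail) ^ (3 / 2 : ℝ) * VR) := by
          rw [hB, Measure.addHaar_ball_center volume x₀ R']
          gcongr
      _ = s2 * Cn * g₃ t + s2 * ((cK * Tail) ^ (3 / 2 : ℝ) * VR) := by ring
  -- ## integrate in time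
  have hμtuniv : μt univ = IT := by rw [hμt, Measure.restrict_apply_univ]
  have hm1 : AEMeasurable (fun t => s2 * Cn * g₃ t) μt := hg₃m.const_mul _
  calc ∫⁻ z in Ioo 0 T ×ˢ B, ‖π z.1 z.2 - c z.1‖ₑ ^ (3 / 2 : ℝ)
      = ∫⁻ t, ∫⁻ x, ‖π t x - c t‖ₑ ^ (3 / 2 : ℝ) ∂μB ∂μt := hTI
    _ ≤ ∫⁻ t, (s2 * Cn * g₃ t + s2 * ((cK * Tail) ^ (3 / 2 : ℝ) * VR)) ∂μt :=
        lintegral_mono_ae hinner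
    _ = s2 * Cn * ∫⁻ t, g₃ t ∂μt + s2 * ((cK * Tail) ^ (3 / 2 : ℝ) * VR) * μt univ := by
        rw [lintegral_add_left' hm1, lintegral_const_mul'' _ hg₃m, lintegral_const]
    _ ≤ s2 * Cn * CUBE + s2 * ((cK * Tail) ^ (3 / 2 : ℝ) * VR) * IT := by
        rw [← hT3, hμtuniv]
        gcongr
    _ = Ktot := by rw [hKtot]

end Literature.Analysis.FluidPDE

end
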